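import Mathlib
import HarnessLib
import Literature.Probability.LatticeModels.LatticeGreenFunction
import Literature.Barriers.CriticalPhenomena.PositionSpaceRGNonGibbsianChessboard
import Summits.QuantumFields.YangMills.Theses.LangevinControlUV

/-!
# Route `LangevinControlUV`, crux `FemtoCurvatureTwoPoint` (stmt-QuantumFields-9363): vocabulary of line `generic-step-gamma-encoding`, II

Part II of the route-posited statements (D-0016 `<Route><Crux>Defs` files) of the skeleton
`Cruxes/FemtoCurvatureTwoPoint/Lines/generic_step_gamma_encoding.lean`, VERBATIM, same namespace as part I
(`…TwoPointDefs.lean`, which see for the conventions: nothing is asserted, every `def … : Prop` is a registered stub's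
statement or conclusion). The two parts are independent (neither imports the other).

* The EVEN-TORUS VARIANCE ROUTE of the diagonal upper bound DU₂ (lead c2, reshapes 2–3): `FixedTorusDoubling` (DBL — the
  conclusion of the LANDED `Theorems.FemtoCurvatureTwoPoint.stub_doubling_of_RV` p114599 from the Literature named fact
  `WilsonPartitionRegularVariation`, Arnold–Gusein-Zade–Varchenko II Thm. 7.6 / Watanabe 2009 Thm. 7.1(1)),
  `PlaquetteProductRPCS` (RPCS — reflection-positivity Cauchy–Schwarz for products of `01`-plaquette functions, block
  reflections `symP/symM` of `Literature.Barriers.CriticalPhenomena.NonGibbs`), `PlaquetteChessboardEven` (CHESS-even — the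
  conclusion of the LANDED `stub_chessboardEven_of_RPCS` p114602), `PlaquetteVarianceEven` (VAR-even — the conclusion of the
  LANDED `stub_varianceEven_of_chessboard_doubling` p115461: `β² Var P ≤ C` on every even torus), and the crux-sized
  remainder `DiagUpperRestOdd` (REST-odd, OPEN core: the variance on odd tori and the two `dist⁸`-weighted profiles).
* The PER-TORUS LIMIT FORM of the core (lead c1): `axisKernel`, `scaledCov`, `SemiclassicalLimits` — existence of the
  fixed-torus limits `lim_{β→∞} β² Cov_{L,β}(P_0^{01}, P_x^{01})` with `L`-uniform two-sided bounds on the limit VALUES; it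
  implies every open stub (`…TwoPointReduction*.lean`), and is offered to the planner as the one-piece statement of the
  missing mathematics (fixed-torus second-order Laplace asymptotics of Wilson's measure near the singular flat variety).
-/

set_option autoImplicit false

noncomputable section

open scoped BigOperators Matrix
open MeasureTheory Filter Topology ProbabilityTheory

namespace Summit.QuantumFields.YangMills.Cruxes.FemtoCurvatureTwoPoint.GenericStepGammaEncoding

open Literature.MathematicalPhysics.QuantumFieldTheory
open Literature.Barriers.CriticalPhenomena.NonGibbs (symP symM)

/-- **DBL — doubling of the fixed-torus partition function** (readable copy of the conclusion of
`stub_doubling_of_RV`): ONE `A`, per-torus thresholds, `Z_L(β/2) ≤ e^{A L⁴} Z_L(β)`. -/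
def FixedTorusDoubling : Prop :=
  ∀ (G : Type) [Group G] [TopologicalSpace G] [IsTopologicalGroup G] [CompactSpace G]
      [MeasurableSpace G] [BorelSpace G] (r : LatticeRep G), ∃ A : ℝ, ∀ (L : ℕ) [NeZero L],
    ∃ B : ℝ, ∀ β : ℝ, B ≤ β →
      (partitionFunction (d := 4) (L := L) r.ρ (β / 2)).toReal ≤
        Real.exp (A * (L : ℝ) ^ 4) * (partitionFunction (d := 4) (L := L) r.ρ β).toReal

/-- **RPCS — reflection Cauchy–Schwarz for products of `01`-plaquette functions** (readable copy of the
statement of `stub_plaquetteProductRPCS`): on an even torus, for `f ≥ 0` bounded measurable and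
`ψ(S) = E[∏_{x∈S} f(P_{(x;01)})]`, `ψ(S)² ≤ ψ(symP i k S) ψ(symM i k S)` for every block reflection
(cells = base points; in-plane directions by site reflections, transverse directions by link reflections). -/
def PlaquetteProductRPCS : Prop :=
  ∀ (G : Type) [Group G] [TopologicalSpace G] [IsTopologicalGroup G] [CompactSpace G]
      [MeasurableSpace G] [BorelSpace G] (N : ℕ) (ρ : G →* Matrix (Fin N) (Fin N) ℂ),
    Continuous ρ → (∀ g, ρ g ∈ Matrix.unitaryGroup (Fin N) ℂ) →
    ∀ (L : ℕ) [NeZero L], Even L → ∀ (β : ℝ), 0 ≤ β →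
    ∀ (f : ℝ → ℝ), Measurable f → (∀ t, 0 ≤ f t) → (∃ M : ℝ, ∀ t, f t ≤ M) →
    ∀ (ψ : Finset (Fin 4 → ZMod L) → ℝ),
      (ψ = fun S => wilsonExpectation (d := 4) (L := L) ρ β
        (fun U => ∏ x ∈ S, f ((N : ℝ) - (ρ (plaquetteHolonomy U x 0 1)).trace.re))) →
      ∀ (i : Fin 4) (k : ZMod L) (S : Finset (Fin 4 → ZMod L)),
        ψ S ^ 2 ≤ ψ (symP i k S) * ψ (symM i k S)

/-- **CHESS-even — chessboard estimate for the `01`-plaquette field on EVERY even torus** (readable copy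
of the conclusion of the LANDED `stub_chessboardEven_of_RPCS`, p114602; reshape 3). -/
def PlaquetteChessboardEven : Prop :=
  ∀ (G : Type) [Group G] [TopologicalSpace G] [IsTopologicalGroup G] [CompactSpace G]
      [MeasurableSpace G] [BorelSpace G] (N : ℕ) (ρ : G →* Matrix (Fin N) (Fin N) ℂ),
    Continuous ρ → (∀ g, ρ g ∈ Matrix.unitaryGroup (Fin N) ℂ) →
    ∀ (L : ℕ) [NeZero L], Even L → ∀ (β : ℝ), 0 ≤ β →
    ∀ (f : ℝ → ℝ), Measurable f → (∀ t, 0 ≤ f t) → (∃ M : ℝ, ∀ t, f t ≤ M) →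
      wilsonExpectation (d := 4) (L := L) ρ β
          (fun U => f ((N : ℝ) - (ρ (plaquetteHolonomy U 0 0 1)).trace.re)) ≤
        (wilsonExpectation (d := 4) (L := L) ρ β
          (fun U => ∏ x : Fin 4 → ZMod L, f ((N : ℝ) - (ρ (plaquetteHolonomy U x 0 1)).trace.re)))
          ^ ((1 : ℝ) / (L : ℝ) ^ 4)

/-- **VAR-even — the variance clause of DU₂ on every even torus** (readable copy of the conclusion of
`stub_varianceEven_of_chessboard_doubling`; reshape 3). -/
def PlaquetteVarianceEven : Prop :=
  ∀ (G : Type) [Group G] [TopologicalSpace G] [IsTopologicalGroup G] [CompactSpace G]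
      [MeasurableSpace G] [BorelSpace G], IsCompactSimpleLieGroup G →
    ∀ (r : LatticeRep G), ∃ (B : ℕ → ℝ) (C : ℝ),
      ∀ (L : ℕ) [NeZero L], Even L → ∀ (β : ℝ), B L ≤ β →
      ∀ (P : (Fin 4 → ZMod L) → Fin 4 → Fin 4 → GaugeConfig 4 L G → ℝ)
        (E : (GaugeConfig 4 L G → ℝ) → ℝ),
        (P = fun x i j U => (r.N : ℝ) - (r.ρ (plaquetteHolonomy U x i j)).trace.re) →
        (E = fun F => wilsonExpectation r.ρ β F) →
      β ^ 2 * |E (fun U => P 0 0 1 U * P 0 0 1 U) - E (P 0 0 1) * E (P 0 0 1)| ≤ C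

/-- **REST-odd — DU₂ without the even variance clause** (readable copy of the statement of
`stub_diagUpperRestOdd`; reshape 3: variance on ODD tori and the two profiles on all tori — the core). -/
def DiagUpperRestOdd : Prop :=
  ∀ (G : Type) [Group G] [TopologicalSpace G] [IsTopologicalGroup G] [CompactSpace G]
      [MeasurableSpace G] [BorelSpace G], IsCompactSimpleLieGroup G →
    ∀ (r : LatticeRep G), ∃ (B : ℕ → ℝ) (C : ℝ),
      ∀ (L : ℕ) [NeZero L] (β : ℝ), B L ≤ β →
      ∀ (P : (Fin 4 → ZMod L) → Fin 4 → Fin 4 → GaugeConfig 4 L G → ℝ)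
        (E : (GaugeConfig 4 L G → ℝ) → ℝ),
        (P = fun x i j U => (r.N : ℝ) - (r.ρ (plaquetteHolonomy U x i j)).trace.re) →
        (E = fun F => wilsonExpectation r.ρ β F) →
      (Odd L →
        β ^ 2 * |E (fun U => P 0 0 1 U * P 0 0 1 U) - E (P 0 0 1) * E (P 0 0 1)| ≤ C) ∧
      ∀ (s : ℕ), 1 ≤ s → s + 1 ≤ L →
        β ^ 2 * (|E (fun U => P 0 0 1 U * P (Pi.single (2 : Fin 4) ((s : ℕ) : ZMod L)) 0 1 U)
            - E (P 0 0 1) * E (P (Pi.single (2 : Fin 4) ((s : ℕ) : ZMod L)) 0 1)|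
          * (min (s : ℝ) ((L : ℝ) - s)) ^ 8) ≤ C ∧
        β ^ 2 * (|E (fun U => P 0 0 1 U * P (Pi.single (0 : Fin 4) ((s : ℕ) : ZMod L)) 0 1 U)
            - E (P 0 0 1) * E (P (Pi.single (0 : Fin 4) ((s : ℕ) : ZMod L)) 0 1)|
          * (min (s : ℝ) ((L : ℝ) - s)) ^ 8) ≤ C

/-- The axis kernel `K_L(ne₂)`: half the sum of the (negative) second differences of the torus Green's
function in the two plaquette directions `e₀, e₁`, evaluated at `n e₂` (the kernel of GD⁻ / K1a). -/
def axisKernel (L n : ℕ) [NeZero L] : ℝ :=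
  ((2 * Literature.Probability.LatticeModels.torusGreen
        (Pi.single (2 : Fin 4) ((n : ℕ) : ZMod L) : Fin 4 → ZMod L)
      - Literature.Probability.LatticeModels.torusGreen
        ((Pi.single (2 : Fin 4) ((n : ℕ) : ZMod L) : Fin 4 → ZMod L)
          + Pi.single (0 : Fin 4) (1 : ZMod L))
      - Literature.Probability.LatticeModels.torusGreen
        ((Pi.single (2 : Fin 4) ((n : ℕ) : ZMod L) : Fin 4 → ZMod L)
          - Pi.single (0 : Fin 4) (1 : ZMod L)))
    + (2 * Literature.Probability.LatticeModels.torusGreen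
        (Pi.single (2 : Fin 4) ((n : ℕ) : ZMod L) : Fin 4 → ZMod L)
      - Literature.Probability.LatticeModels.torusGreen
        ((Pi.single (2 : Fin 4) ((n : ℕ) : ZMod L) : Fin 4 → ZMod L)
          + Pi.single (1 : Fin 4) (1 : ZMod L))
      - Literature.Probability.LatticeModels.torusGreen
        ((Pi.single (2 : Fin 4) ((n : ℕ) : ZMod L) : Fin 4 → ZMod L)
          - Pi.single (1 : Fin 4) (1 : ZMod L)))) / 2

/-- The scaled diagonal plaquette covariance `β ↦ β² · Cov_{L,β}(P_0^{01}, P_x^{01})`,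
`P = N − Re tr r(U_p)`, as a function of the coupling (for limits `β → ∞` at fixed `L`). -/
def scaledCov {G : Type} [Group G] [TopologicalSpace G] [IsTopologicalGroup G] [CompactSpace G]
    [MeasurableSpace G] [BorelSpace G] (r : LatticeRep G) (L : ℕ) [NeZero L]
    (x : Fin 4 → ZMod L) (β : ℝ) : ℝ :=
  β ^ 2 *
    (wilsonExpectation r.ρ β (fun U : GaugeConfig 4 L G =>
        ((r.N : ℝ) - (r.ρ (plaquetteHolonomy U 0 0 1)).trace.re) *
          ((r.N : ℝ) - (r.ρ (plaquetteHolonomy U x 0 1)).trace.re))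
      - wilsonExpectation r.ρ β (fun U : GaugeConfig 4 L G =>
          (r.N : ℝ) - (r.ρ (plaquetteHolonomy U 0 0 1)).trace.re)
        * wilsonExpectation r.ρ β (fun U : GaugeConfig 4 L G =>
          (r.N : ℝ) - (r.ρ (plaquetteHolonomy U x 0 1)).trace.re))

/-- **Per-torus semiclassical LIMITS (the natural output of a fixed-`L` Laplace expansion) with
`L`-uniform bounds on the LIMIT VALUES.** For every compact simple `G` and faithful unitary `r` there
are `κ₀ > 0` and `C₀` such that on every torus `(ℤ/L)⁴` the limits
`ℓ_L(x) = lim_{β→∞} β² Cov_{L,β}(P_0^{01}, P_x^{01})` EXIST for all `x` and satisfy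
`κ₀ K_L(ne₂)² ≤ ℓ_L(ne₂)` (`8n ≤ L`), `|ℓ_L(0)| ≤ C₀`, and
`|ℓ_L(s e₂)|, |ℓ_L(s e₀)| ≤ C₀ / min(s, L−s)⁸` (`1 ≤ s ≤ L−1`). No rate and no uniformity of the
expansion in `L` is asked — only uniform bounds on the limiting (toron-averaged Gaussian) values.
This implies both open stubs (`semiclassics_of_limits`, proved below, thresholds extracted from the
limits torus by torus); it is offered to the planner as an equivalent-in-practice target. -/
def SemiclassicalLimits : Prop :=
  ∀ (G : Type) [Group G] [TopologicalSpace G] [IsTopologicalGroup G] [CompactSpace G]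
      [MeasurableSpace G] [BorelSpace G], IsCompactSimpleLieGroup G →
    ∀ (r : LatticeRep G), ∃ κ₀ : ℝ, 0 < κ₀ ∧ ∃ C₀ : ℝ, ∀ (L : ℕ) [NeZero L],
      ∃ ℓ : (Fin 4 → ZMod L) → ℝ,
        (∀ x : Fin 4 → ZMod L,
            Filter.Tendsto (scaledCov r L x) Filter.atTop (nhds (ℓ x))) ∧
        (∀ n : ℕ, 1 ≤ n → 8 * n ≤ L →
            κ₀ * axisKernel L n ^ 2 ≤ ℓ (Pi.single (2 : Fin 4) ((n : ℕ) : ZMod L))) ∧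
        |ℓ 0| ≤ C₀ ∧
        (∀ s : ℕ, 1 ≤ s → s + 1 ≤ L →
            |ℓ (Pi.single (2 : Fin 4) ((s : ℕ) : ZMod L))| * (min (s : ℝ) ((L : ℝ) - s)) ^ 8 ≤ C₀ ∧
            |ℓ (Pi.single (0 : Fin 4) ((s : ℕ) : ZMod L))| * (min (s : ℝ) ((L : ℝ) - s)) ^ 8 ≤ C₀)

/-- **Limits ⇒ REST-odd** (the open upper-side stub is implied by the per-torus limit form, with
`C = C₀ + 1`: margin `1` for the variance clause and `1 / min(s, L−s)⁸` for the weighted clauses; finitely many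
`s` per torus give one threshold `B(L)`; the parity guard of the variance clause is not used). Registered
sub-goal of the crux item; the twin `SemiclassicalLimits → DiagUpperTwoProfiles` is in the reduction files. -/
theorem diagUpperRestOdd_of_limits (h : SemiclassicalLimits) : DiagUpperRestOdd := by
  intro G _ _ _ _ _ _ hG r
  obtain ⟨κ₀, -, C₀, hLim⟩ := h G hG r
  classical
  have hB : ∀ L : ℕ, ∃ B : ℝ, ∀ (hL0 : L ≠ 0) (β : ℝ), B ≤ β →
      haveI : NeZero L := ⟨hL0⟩
      |scaledCov r L 0 β| ≤ C₀ + 1 ∧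
      ∀ s : ℕ, 1 ≤ s → s + 1 ≤ L →
        |scaledCov r L (Pi.single (2 : Fin 4) ((s : ℕ) : ZMod L)) β|
            * (min (s : ℝ) ((L : ℝ) - s)) ^ 8 ≤ C₀ + 1 ∧
        |scaledCov r L (Pi.single (0 : Fin 4) ((s : ℕ) : ZMod L)) β|
            * (min (s : ℝ) ((L : ℝ) - s)) ^ 8 ≤ C₀ + 1 := by
    intro L
    by_cases hL0 : L = 0
    · exact ⟨0, fun h => absurd hL0 h⟩
    haveI : NeZero L := ⟨hL0⟩
    obtain ⟨ℓ, hT, -, h0, hs⟩ := hLim L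
    -- from `dist (f β) ℓ < ε` to the weighted bound
    have key : ∀ (x : Fin 4 → ZMod L) (w : ℝ), 0 < w → |ℓ x| * w ≤ C₀ →
        ∀ᶠ β : ℝ in Filter.atTop, |scaledCov r L x β| * w ≤ C₀ + 1 := by
      intro x w hw hℓ
      have hev := Metric.tendsto_nhds.1 (hT x) (1 / w) (by positivity)
      refine hev.mono fun β hβ => ?_
      rw [Real.dist_eq] at hβ
      have h1 : |scaledCov r L x β| ≤ |ℓ x| + |scaledCov r L x β - ℓ x| := by
        have := abs_add_le (ℓ x) (scaledCov r L x β - ℓ x)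
        rwa [add_sub_cancel] at this
      have h2 : |scaledCov r L x β - ℓ x| * w ≤ 1 := by
        have := mul_le_mul_of_nonneg_right hβ.le hw.le
        rwa [one_div, inv_mul_cancel₀ hw.ne'] at this
      nlinarith [mul_le_mul_of_nonneg_right h1 hw.le]
    have ev0 : ∀ᶠ β : ℝ in Filter.atTop, |scaledCov r L 0 β| ≤ C₀ + 1 := by
      have := key 0 1 one_pos (by simpa using h0)
      simpa using this
    have evs : ∀ s ∈ Finset.range (L + 1), ∀ᶠ β : ℝ in Filter.atTop, 1 ≤ s → s + 1 ≤ L →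
        |scaledCov r L (Pi.single (2 : Fin 4) ((s : ℕ) : ZMod L)) β|
            * (min (s : ℝ) ((L : ℝ) - s)) ^ 8 ≤ C₀ + 1 ∧
        |scaledCov r L (Pi.single (0 : Fin 4) ((s : ℕ) : ZMod L)) β|
            * (min (s : ℝ) ((L : ℝ) - s)) ^ 8 ≤ C₀ + 1 := by
      intro s _
      by_cases hsd : 1 ≤ s ∧ s + 1 ≤ L
      · obtain ⟨hs1, hsL⟩ := hsd
        have hw : 0 < (min (s : ℝ) ((L : ℝ) - s)) ^ 8 := by
          apply pow_pos
          apply lt_min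
          · exact_mod_cast hs1
          · have : (s : ℝ) + 1 ≤ (L : ℝ) := by exact_mod_cast hsL
            linarith
        obtain ⟨hs2, hs0⟩ := hs s hs1 hsL
        exact ((key _ _ hw hs2).and (key _ _ hw hs0)).mono fun β hβ _ _ => hβ
      · exact Filter.Eventually.of_forall fun β h1 h2 => absurd ⟨h1, h2⟩ hsd
    obtain ⟨B, hB⟩ := Filter.eventually_atTop.1
      (ev0.and ((Filter.eventually_all_finset _).2 evs))
    refine ⟨B, fun _ β hβ => ⟨(hB β hβ).1, fun s hs1 hsL => ?_⟩⟩
    have hmem : s ∈ Finset.range (L + 1) := by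
      rw [Finset.mem_range]; omega
    exact (hB β hβ).2 s hmem hs1 hsL
  choose B hB using hB
  refine ⟨B, C₀ + 1, fun L _ β hβ P E hP hE => ?_⟩
  subst hP hE
  obtain ⟨h0', hs'⟩ := hB L (NeZero.ne L) β hβ
  refine ⟨fun _ => ?_, fun s hs1 hsL => ?_⟩
  · have h := h0'
    simp only [scaledCov, abs_mul, abs_pow, sq_abs] at h
    simpa only using h
  · obtain ⟨h2, h0⟩ := hs' s hs1 hsL
    simp only [scaledCov, abs_mul, abs_pow, sq_abs, mul_assoc] at h2 h0
    exact ⟨by simpa only [mul_assoc] using h2, by simpa only [mul_assoc] using h0⟩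

end Summit.QuantumFields.YangMills.Cruxes.FemtoCurvatureTwoPoint.GenericStepGammaEncoding

end
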